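import Literature.AlgebraicGeometry.Frobenioids.ModelFrobenioidComparisonFull2
import Literature.AlgebraicGeometry.Frobenioids.ArchimedeanBasicProperties
import HarnessLib

/-!
# Frobenioids II, Theorem 3.6 (i) "model type, with rational function monoid ≅ …": the BRIDGE from
# [FrdI] Thm. 5.2 (iv) to the typed equivalence `Thm36i_istrModel` (generic, proof-only)

Mochizuki, *The geometry of Frobenioids II: poly-Frobenioids*, Kyushu J. Math. **62** (2008)
401–460, §3, Theorem 3.6 (i), kurims text p. 36 ll. 34–35 [cite: MochizukiFrdII2008, Thm 3.6 (i) p.36]: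
"The Frobenioid `(C^Λ)^istr` is of isotropic, base-trivial, and model type, with rational function monoid
naturally isomorphic to `(Φ^fld)^Λ`"; [FrdI] Thm. 5.2 (iv) p. 101 (in the author's 2024 Comments form, the
tree's `PreFrobenioid.Thm52iv`, PROVED as `thm52iv_holds'`): a Frobenioid of isotropic and model type with
rational function monoid `(B, Div_B)` is equivalent, compatibly with the structure functors, to the model
Frobenioid of `(Φ, B, Div_B)` [cite: MochizukiFrdI2008, Thm. 5.2(iv) p.101].

PROOF-ONLY file (abc-iut cell, layer L1, row M13-c3 of HOME/staging/L1/L1-t6/g3/M13-c3-DESIGN.md, the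
generic plumbing of piece P4; seat abc-iut-L1-t6).  abc-iut-L1-t9's typed predicate
`ArchFrd.Thm36i_istrModel F FM := ∃ e : F^istr ≌ M, Nonempty (e.functor ⋙ FM ≅ istr F)`
(`ArchimedeanBasicProperties.lean`) is DERIVED, for ANY Frobenioid `F : X → F_Φ` and ANY model datum
`(B, Div_B)` carrying a rational function monoid structure of `F` ([FrdI] Prop. 4.4 (ii), abc-iut-L6-t8's
`PreFrobenioid.RationalFunctionMonoidStr F hF B DivB`), from: `F` of isotropic type, `F` of model type
([FrdI] Def. 4.5 (i), `PreFrobenioid.IsOfModelType`), via `thm52iv_holds'` — `thm36i_istrModel_of_isOfModelType`.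
So each `Λ`-instance of the "model type" clause reduces to (isotropic type) + (model type) + (the rational
function monoid identification); for `Λ = ℚ` these are `Thm36Sub.istrAll_Q_holds`, `Thm36Sub.pf_isOfModelType`
(`ArchimedeanModelType.lean`) and the P2/P3 structure of the design.  Classical; no side taken on
[IUTchIII] Cor. 3.12; no definitions.
-/

namespace Literature.AlgebraicGeometry.Frobenioids

open CategoryTheory

universe w v v' u u'

namespace ArchFrd

variable {D : Type u} [Category.{v} D] {Φ : Dᵒᵖ ⥤ CommMonCat.{w}} {X : Type u'} [Category.{v'} X]
  {F : X ⥤ ElemFrobenioid Φ}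

/-- For a Frobenioid of isotropic type the inclusion `F^istr ⊆ F` is an equivalence ("`(C^Λ)^istr = C^Λ`"
as categories). [cite: MochizukiFrdII2008, Thm 3.6 (i) p.36] -/
theorem isEquivalence_istr_ι (hiso : PreFrobenioid.IsOfIsotropicType F) :
    (PreFrobenioid.isotropicObjects F).ι.IsEquivalence :=
  haveI : (PreFrobenioid.isotropicObjects F).ι.EssSurj := ⟨fun Y => ⟨⟨Y, hiso Y⟩, ⟨Iso.refl _⟩⟩⟩
  {}

/-- **Bridge [FrdI] Thm. 5.2 (iv) ⇒ [FrdII] Thm. 3.6 (i) "model type with rational function monoid `B`".**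
If the Frobenioid `F : X → F_Φ` is of isotropic type and of model type (Def. 4.5 (i), at the Prop. 1.11 (vii)
square completion), then for every model datum `(B, Div_B)` with a rational function monoid structure of `F`,
`F^istr` is equivalent to the model Frobenioid of `(Φ, B, Div_B)` compatibly with the structure functors —
abc-iut-L1-t9's `Thm36i_istrModel F (ModelFrobenioid.toElem Φ B DivB)`. [cite: MochizukiFrdII2008, Thm 3.6 (i) p.36] -/
theorem thm36i_istrModel_of_isOfModelType (hF : PreFrobenioid.IsFrobenioid F)
    (hiso : PreFrobenioid.IsOfIsotropicType F)
    (hm : PreFrobenioid.IsOfModelType F hF (PreFrobenioid.hasBiratSquares_of_isFrobenioid hF))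
    {B : Dᵒᵖ ⥤ CommMonCat.{w}} {DivB : B ⟶ monoidGp Φ}
    (R : PreFrobenioid.RationalFunctionMonoidStr F hF B DivB) :
    Thm36i_istrModel F (ModelFrobenioid.toElem Φ B DivB) := by
  obtain ⟨E, hE, ⟨c⟩⟩ := PreFrobenioid.thm52iv_holds' hF ⟨hm, hiso⟩ B DivB R
  haveI := hE
  haveI := isEquivalence_istr_ι hiso
  refine ⟨(PreFrobenioid.isotropicObjects F).ι.asEquivalence.trans E.asEquivalence, ⟨?_⟩⟩
  exact Functor.associator _ _ _ ≪≫ Functor.isoWhiskerLeft _ (c ≪≫ F.rightUnitor)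

/-- The same with the model-type hypothesis at an ARBITRARY square-completion witness `hsq` (the predicate
does not depend on the witness up to the canonical comparison; here simply re-fed through `thm52iv_holds`).
[cite: MochizukiFrdII2008, Thm 3.6 (i) p.36] -/
theorem thm36i_istrModel_of_isOfModelType' (hF : PreFrobenioid.IsFrobenioid F)
    {hsq : PreFrobenioid.HasBiratSquares F} (hiso : PreFrobenioid.IsOfIsotropicType F)
    (hm : PreFrobenioid.IsOfModelType F hF hsq)
    {B : Dᵒᵖ ⥤ CommMonCat.{w}} {DivB : B ⟶ monoidGp Φ}
    (R : PreFrobenioid.RationalFunctionMonoidStr F hF B DivB) :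
    Thm36i_istrModel F (ModelFrobenioid.toElem Φ B DivB) := by
  obtain ⟨E, hE, ⟨c⟩⟩ := PreFrobenioid.thm52iv_holds hF hsq ⟨hm, hiso⟩ B DivB R
  haveI := hE
  haveI := isEquivalence_istr_ι hiso
  refine ⟨(PreFrobenioid.isotropicObjects F).ι.asEquivalence.trans E.asEquivalence, ⟨?_⟩⟩
  exact Functor.associator _ _ _ ≪≫ Functor.isoWhiskerLeft _ (c ≪≫ F.rightUnitor)

end ArchFrd

end Literature.AlgebraicGeometry.Frobenioids
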